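import Literature.RingTheory.KTheory.MilnorKStarModTwoGraded
import HarnessLib

/-!
# The Stiefel–Whitney invariants `wᵢ(M) ∈ kᵢF` of a diagonalized quadratic module: elementary symmetric functions,
# `w = 1 + w₁ + ⋯ + w_r`, and invariance under chain equivalence (Milnor, *Algebraic K-theory and quadratic forms*,
# Invent. Math. 9 (1970), §3)

Family `hodge`, lane `lit-hodgefound` (foundations library; seat `lit-hodgefound-p27`, generation 40, row g40-#16);
topic `RingTheory/KTheory`.  Sequel of `MilnorKStiefelWhitney` (g40-#14: the ring `k_*F = Mod2Ring F`, `kl`, the total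
invariant `sw F d = ∏ (1 + l(aᵢ))`, `ChainEquiv`, `sw_eq_of_chainEquiv`) and `MilnorKStarModTwoGraded` (g40-#15: the
degree-`n` parts `kRange F n` of `k_*F`, `iSupIndep_kRange`).  ONE DEFINITION WITH BODY (`swComp`) and PROVED THEOREMS;
no named fact, no instance, no notation, 0 `sorry`, net debt 0 (D-0026).

## The source, verbatim

J. Milnor, *Algebraic K-theory and quadratic forms*, Invent. Math. 9 (1970) 318–344 (held `paper:doi-10-1007-bf01425486`;
bib key `Milnor1970`), §3 (p0011 L4–L12): «w(M) = (1 + l(a₁))(1 + l(a₂))⋯(1 + l(a_r)). Thus w(M) can be written as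
1 + w₁(M) + w₂(M) + ⋯ + w_r(M) where the first Stiefel-Whitney invariant w₁(M) = l(a₁) + ⋯ + l(a_r) ∈ k₁F […] the
second Stiefel-Whitney invariant is equal to w₂(M) = Σ_{i<j} l(aᵢ)l(aⱼ) ∈ k₂F […] and in general the i-th
Stiefel-Whitney invariant wᵢ(M) is equal to the i-th elementary symmetric function of l(a₁), …, l(a_r), considered as
an element of kᵢF. For i > r the definition implies that wᵢ(M) = 0.»  And LEMMA 3.1 (p0011 L24–L29): «The invariant
w(M) is a well defined unit in the ring k_ΠF […] it suffices to consider the rank 2 case.»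

## What is formalised

* **`swComp F i d`**, the `i`-th Stiefel–Whitney invariant of the diagonal form `d = [a₁, …, a_r]`: the `i`-th
  elementary symmetric function of `l(a₁), …, l(a_r)` — the sum over the `i`-element sub-diagonals
  (`List.sublistsLen i d`) of the products `l(a_{j₁})⋯l(a_{jᵢ})` — in `k_*F`; `swComp_zero : w₀ = 1`,
  `swComp_succ_cons` (the recursion `wᵢ₊₁((a) ⊕ M) = wᵢ₊₁(M) + l(a) wᵢ(M)`), `swComp_of_length_lt : wᵢ = 0` for `i > r`.
* **`sw_eq_sum_swComp : w = Σ_{i ≤ r} wᵢ`** («w(M) can be written as 1 + w₁(M) + ⋯ + w_r(M)»).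
* **`swComp_mem_kRange : wᵢ ∈ kᵢF`** (the degree-`i` part `kRange F i` of `k_*F`, which is `kᵢF` by `kOfDeg_injective`).
* **`eq_of_sum_eq_sum`**: uniqueness of the homogeneous decomposition in `k_*F = ⊕ₙ k_nF` (finite sums, from
  `iSupIndep_kRange`), proved additively in characteristic `2`.
* **`swComp_eq_of_chainEquiv`**: LEMMA 3.1 for each `wᵢ` — chain-equivalent diagonalizations (`ChainEquiv`, which
  preserve the rank, `length_eq_of_chainEquiv`) have the same `wᵢ` for every `i` (characteristic `≠ 2`), from
  `sw_eq_of_chainEquiv` and uniqueness of the decomposition.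

Not here (as in `MilnorKStiefelWhitney`): Witt's chain-equivalence theorem, the ring `k_ΠF`.

## References

* [Milnor1970] J. Milnor, *Algebraic K-theory and quadratic forms*, Invent. Math. 9 (1970) 318–344 — §3, the
  Stiefel–Whitney invariants `wᵢ` (p0011 L4–L12), Lemma 3.1 (p0011 L24–L29).

Provenance: lane `lit-hodgefound`, seat `lit-hodgefound-p27` gen 40 (agent `literature-prover-lit-hodgefound-p27-g40-0`),
row g40-#16.
-/

set_option autoImplicit false

noncomputable section

namespace Literature.RingTheory.KTheory

open Function

/-! ### the Stiefel–Whitney invariants `wᵢ`: elementary symmetric functions -/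

section Components

variable (F : Type*) [Field F]

namespace MilnorKStar

/-- **The `i`-th Stiefel–Whitney invariant `wᵢ` of the diagonal form `⟨a₁, …, a_r⟩`: the `i`-th elementary symmetric
function of `l(a₁), …, l(a_r)`** — the sum over the `i`-element sub-diagonals of the products `l(a_{j₁})⋯l(a_{jᵢ})`, in
`k_*F`. [cite: Milnor1970, §3 «the i-th Stiefel-Whitney invariant wᵢ(M) is equal to the i-th elementary symmetric function of l(a₁), …, l(a_r)» (p0011 L10–L12)] -/
def swComp (i : ℕ) (d : List Fˣ) : Mod2Ring F := ((d.sublistsLen i).map fun s => (s.map (kl F)).prod).sum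

/-- `w₀ = 1`. [cite: Milnor1970, §3, the invariants wᵢ (p0011 L6–L12)] -/
theorem swComp_zero (d : List Fˣ) : swComp F 0 d = 1 := by
  rw [swComp, List.sublistsLen_zero]; simp

/-- `wᵢ₊₁` of the zero module vanishes. [cite: Milnor1970, §3, the invariants wᵢ (p0011 L6–L12)] -/
theorem swComp_succ_nil (i : ℕ) : swComp F (i + 1) [] = 0 := by
  rw [swComp, List.sublistsLen_succ_nil]; rfl

/-- The recursion of the elementary symmetric functions: `wᵢ₊₁((a) ⊕ M) = wᵢ₊₁(M) + l(a) wᵢ(M)`. [cite: Milnor1970, §3, the invariants wᵢ (p0011 L6–L12)] -/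
theorem swComp_succ_cons (i : ℕ) (a : Fˣ) (d : List Fˣ) :
    swComp F (i + 1) (a :: d) = swComp F (i + 1) d + kl F a * swComp F i d := by
  rw [swComp, List.sublistsLen_succ_cons, List.map_append, List.sum_append, swComp, swComp, List.map_map,
    ← List.sum_map_mul_left]
  rfl

/-- **«For i > r the definition implies that wᵢ(M) = 0.»** [cite: Milnor1970, §3 (p0011 L12)] -/
theorem swComp_of_length_lt {i : ℕ} {d : List Fˣ} (h : d.length < i) : swComp F i d = 0 := by
  rw [swComp, List.sublistsLen_of_length_lt h]; rfl

/-- **`w = 1 + w₁ + w₂ + ⋯ + w_r`** («Thus w(M) can be written as 1 + w₁(M) + w₂(M) + ⋯ + w_r(M)»). [cite: Milnor1970, §3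
(p0011 L6–L7)] -/
theorem sw_eq_sum_swComp (d : List Fˣ) : sw F d = ∑ i ∈ Finset.range (d.length + 1), swComp F i d := by
  induction d with
  | nil => rw [sw_nil, List.length_nil, zero_add, Finset.sum_range_one, swComp_zero]
  | cons a d ih =>
    rw [sw_cons, ih, List.length_cons, Finset.sum_range_succ' _ (d.length + 1), swComp_zero]
    simp only [swComp_succ_cons]
    rw [Finset.sum_add_distrib, ← Finset.mul_sum, Finset.sum_range_succ (fun i => swComp F (i + 1) d),
      swComp_of_length_lt F (Nat.lt_succ_self _), add_zero, add_mul, one_mul]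
    have h : ∑ i ∈ Finset.range (d.length + 1), swComp F i d =
        ∑ i ∈ Finset.range d.length, swComp F (i + 1) d + swComp F 0 d := by
      rw [Finset.sum_range_succ' _ d.length]
    rw [h, swComp_zero]
    abel

/-- A product of `i` letters `l(a_{j₁})⋯l(a_{jᵢ})` lies in the image of `kᵢF`. [cite: Milnor1970, §3 «k_*F is a graded algebra over Z/2Z» (p0010 L30–L31)] -/
theorem prod_map_kl_mem_kRange (s : List Fˣ) : (s.map (kl F)).prod ∈ kRange F s.length := by
  refine ⟨MilnorK.kSymbol fun j => s.get j, ?_⟩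
  rw [kOfDeg_kSymbol]
  congr 1
  conv_rhs => rw [← List.ofFn_get (l := s), List.map_ofFn]
  rfl

/-- **`wᵢ ∈ kᵢF`** («considered as an element of kᵢF»): `wᵢ` lies in the degree-`i` part of `k_*F`. [cite: Milnor1970, §3 «the i-th Stiefel-Whitney invariant wᵢ(M) is equal to the i-th elementary symmetric function of l(a₁), …, l(a_r)» (p0011 L10–L12)] -/
theorem swComp_mem_kRange (i : ℕ) (d : List Fˣ) : swComp F i d ∈ kRange F i := by
  refine AddSubgroup.list_sum_mem _ (fun x hx => ?_)
  obtain ⟨s, hs, rfl⟩ := List.mem_map.1 hx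
  rw [← List.length_of_sublistsLen hs]
  exact prod_map_kl_mem_kRange F s

/-- Uniqueness of the homogeneous decomposition in `k_*F = ⊕ₙ k_nF`: finite sums of homogeneous elements agree only
termwise (from `iSupIndep_kRange`; additive proof in characteristic `2`). [cite: Milnor1970, §3 «k_*F is a graded algebra over Z/2Z» (p0010 L30–L31)] -/
theorem eq_of_sum_eq_sum {N : ℕ} {x y : ℕ → Mod2Ring F} (hx : ∀ i, x i ∈ kRange F i) (hy : ∀ i, y i ∈ kRange F i)
    (h : ∑ i ∈ Finset.range N, x i = ∑ i ∈ Finset.range N, y i) {j : ℕ} (hj : j < N) : x j = y j := by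
  classical
  -- `z i = x i + y i` has `∑ z = 0`, each `z i ∈ kRange i`
  have hz : ∑ i ∈ Finset.range N, (x i + y i) = 0 := by
    rw [Finset.sum_add_distrib, h]; exact add_self F _
  have hjN : j ∈ Finset.range N := Finset.mem_range.2 hj
  rw [← Finset.add_sum_erase _ _ hjN] at hz
  -- characteristic `2`: `a + S = 0 ⇒ a = S` (no subtraction needed)
  have hS : x j + y j = ∑ i ∈ (Finset.range N).erase j, (x i + y i) := by
    have h1 := congrArg (fun t => t + ∑ i ∈ (Finset.range N).erase j, (x i + y i)) hz
    simp only [zero_add] at h1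
    rwa [add_assoc, add_self, add_zero] at h1
  have hmem : x j + y j ∈ ⨆ i, ⨆ (_ : i ≠ j), kRange F i := by
    rw [hS]
    refine Finset.sum_induction _ (fun t => t ∈ ⨆ i, ⨆ (_ : i ≠ j), kRange F i) (fun a b ha hb => add_mem ha hb)
      (zero_mem _) (fun i hi => ?_)
    have hij : i ≠ j := Finset.ne_of_mem_erase hi
    exact AddSubgroup.mem_iSup_of_mem i (AddSubgroup.mem_iSup_of_mem hij (add_mem (hx i) (hy i)))
  have h0 : x j + y j = 0 :=
    (AddSubgroup.disjoint_def.1 (iSupIndep_kRange F j)) (add_mem (hx j) (hy j)) hmem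
  exact (eq_neg_of_add_eq_zero_left h0).trans (eq_neg_of_add_eq_zero_left (add_self F (y j))).symm

/-- Chain steps preserve the rank. [cite: Milnor1970, §3 Lemma 3.1 (p0011 L24–L29)] -/
theorem length_eq_of_chainStep {d d' : List Fˣ} (h : ChainStep F d d') : d.length = d'.length := by
  cases h with
  | pair d₁ d₂ h => simp only [List.length_append, List.length_cons]

/-- Chain-equivalent diagonalizations have the same rank. [cite: Milnor1970, §3 Lemma 3.1 (p0011 L24–L29)] -/
theorem length_eq_of_chainEquiv {d d' : List Fˣ} (h : ChainEquiv F d d') : d.length = d'.length := by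
  induction h with
  | rel x y hxy => exact length_eq_of_chainStep F hxy
  | refl x => rfl
  | symm x y _ ih => exact ih.symm
  | trans x y z _ _ ih₁ ih₂ => exact ih₁.trans ih₂

/-- **LEMMA 3.1 for the individual invariants: chain-equivalent diagonalizations have the same `wᵢ ∈ kᵢF` for every `i`**
(characteristic `≠ 2`; modulo Witt's chain-equivalence theorem, as in `sw_eq_of_chainEquiv`). [cite: Milnor1970, §3 Lemma 3.1 (p0011 L24–L29)] -/
theorem swComp_eq_of_chainEquiv (h2 : (2 : F) ≠ 0) {d d' : List Fˣ} (h : ChainEquiv F d d') (i : ℕ) :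
    swComp F i d = swComp F i d' := by
  have hlen := length_eq_of_chainEquiv F h
  by_cases hi : i < d.length + 1
  · have hsum : ∑ i ∈ Finset.range (d.length + 1), swComp F i d = ∑ i ∈ Finset.range (d.length + 1), swComp F i d' := by
      rw [← sw_eq_sum_swComp, sw_eq_of_chainEquiv F h2 h, hlen, ← sw_eq_sum_swComp]
    exact eq_of_sum_eq_sum F (fun i => swComp_mem_kRange F i d) (fun i => swComp_mem_kRange F i d') hsum hi
  · rw [swComp_of_length_lt F (by omega), swComp_of_length_lt F (by omega)]

end MilnorKStar

end Components

end Literature.RingTheory.KTheory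

end
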